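import Summits.BirchSwinnertonDyer.BirchSwinnertonDyer.Theses.KatoDescentPotSupersingular
import Summits.BirchSwinnertonDyer.Rank1Residual.O6.X3KatoMemberBoundOfHullReadings
import HarnessLib

/-!
# Route `KatoDescentPotSupersingular` (rung K9, cell `bsd-potss`): the crux `ReducibleKatoMember`
# (item stmt-BirchSwinnertonDyer-19196) PROVED OVER THE THREE HULL READINGS — a `--supports` file

The crux M of the route is, by name, cell `b2b-bsdres`'s typed node
`Summit.BirchSwinnertonDyer.Rank1Residual.O6.KatoMemberShaBoundOfReducible` (o6-r1's T-X3K): at an odd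
additive potentially good prime `p` with `E[p]` reducible, SOME `ℚ`-isogenous `W'` (Kato's member
`W_K`, `T_pW_K ≅ V_{ℤ_p}(f)(1)`) satisfies
`ord_p #Ш(W')[p^∞] + ord_p Tam(W') ≤ ord_p (L(W',1)/Ω(W')) + 3·ord_p #W'(ℚ)_tors`.
The tree theorem `O6.katoMemberShaBoundOfReducible_of_hullReadings`
(`Summits/…/Rank1Residual/O6/X3KatoMemberBoundOfHullReadings.lean`, seat kmc part 12) derives it from
three displayed hypothesis schemata over the interface `KatoHullDescentDatum` / `IsHullOf` — Kato's
member carries a realised hull datum (M1), the height-one divisibility for the hull on the reducible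
rows (M2: Kato Thm. 12.5 (3) off `(p)`, Wuthrich 2014 Lemma 14 at `(p)`), the rank-`0` count at a
member with `p`-torsion (M3: Prop. 14.16 (2) + Lemma T + the additive local index) — and the kernel
algebra `Kato2004.padicValNat_natCard_coinvariants_add_le_of_hull` (part 11: Kato §14.14–14.15 run
through the reflexive hull of `𝐇¹(T)`, no defect from the hull index). This file restates that
theorem with the ROUTE DECL as its type. CONDITIONAL (audit `proof.conditional`): the item is NOT
closed; the three readings are its honest residue (D-O6-2-type interface). Seat `bsd-potss-kmc`
generation 6.

References: [Kato2004Asterisque] Thm. 12.6 (p. 222), §14.14 and Lemma 14.15 (pp. 243–244), Prop.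
14.16 (2) (p. 244); [Wuthrich2014] §3.2, Lemma 11, 12, 14.
-/

set_option autoImplicit false
-- sibling precedent (`KatoDescentPotSupersingularAssembly.lean`): the directory name repeats the summit name
set_option linter.dupNamespace false

noncomputable section

open scoped Classical

namespace Summit.BirchSwinnertonDyer.BirchSwinnertonDyer.Theorems

open WeierstrassCurve Summit.BirchSwinnertonDyer.Rank1Residual
  Summit.BirchSwinnertonDyer.Rank1Residual.Additive

/-- **The K9 crux `ReducibleKatoMember` over the three hull readings** (route
`KatoDescentPotSupersingular`, item stmt-BirchSwinnertonDyer-19196; type = the route decl verbatim):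
Kato's member bound T-X3K from `KatoHull.MemberRealizable`, `KatoHull.DivisibilityReading`,
`KatoHull.CountReading` over the interface predicate `IsHullOf`, by the tree theorem
`O6.katoMemberShaBoundOfReducible_of_hullReadings`. Conditional over displayed readings; nothing
about Kato's objects is asserted; the item is not closed by this theorem.
[cite: Kato2004Asterisque, Thm. 12.6 (p. 222), §14.14 and Lemma 14.15 (pp. 243–244), Prop. 14.16 (2) (p. 244)]
[cite: Wuthrich2014, Lemma 11, Lemma 12 (pp. 394–395), Lemma 14 (p. 396)] -/
theorem reducibleKatoMember_of_hullReadings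
    {IsHullOf : ∀ (W : WeierstrassCurve ℚ) [W.IsElliptic] [W.IsGloballyMinimal] (p : ℕ)
      [Fact p.Prime], KatoHullDescentDatum p → Prop}
    (hM : KatoHull.MemberRealizable IsHullOf) (hD : KatoHull.DivisibilityReading IsHullOf)
    (hC : KatoHull.CountReading IsHullOf) :
    Summit.BirchSwinnertonDyer.BirchSwinnertonDyer.Theses.KatoDescentPotSupersingular.ReducibleKatoMember :=
  O6.katoMemberShaBoundOfReducible_of_hullReadings hM hD hC

end Summit.BirchSwinnertonDyer.BirchSwinnertonDyer.Theorems

end
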